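import Mathlib
import Summits.RiemannHypothesis.RiemannHypothesis.Theorems.WeilFormatCCellShiftCertA1p3
import HarnessLib

/-!
# Kernel class parts 2–3 of the cell-refined shift certificate `cellA1p3`

Helper file (`--supports stmt-RiemannHypothesis-0098`), RH-free; seat rh-explicit-weil-1 gen3.  One `decide +kernel` pair pass
per class part of `CellSOS.cellA1p3` (`WeilFormatCCellShiftCertA1p3.lean`); consumed by the bound file together with `cellA1p3_check`.
-/

set_option linter.dupNamespace false

namespace Summit.RiemannHypothesis.RiemannHypothesis.Theorems.WeilFormatC.CellSOS

set_option maxHeartbeats 0 in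
/-- Class part 2 of `cellA1p3` is within its claimed bound (kernel pair pass). [folklore] -/
theorem cellA1p3_part2 : cellA1p3.checkPart 2 = true := by
  decide +kernel

set_option maxHeartbeats 0 in
/-- Class part 3 of `cellA1p3` is within its claimed bound (kernel pair pass). [folklore] -/
theorem cellA1p3_part3 : cellA1p3.checkPart 3 = true := by
  decide +kernel

end Summit.RiemannHypothesis.RiemannHypothesis.Theorems.WeilFormatC.CellSOS
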